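import Summits.SmoothPoincare4.SmoothPoincare4.Theses.EntropyRung
import Summits.SmoothPoincare4.SmoothPoincare4.Theorems.EntropyRungSubcylindricalRecognitionOfBamler
import Summits.SmoothPoincare4.SmoothPoincare4.Theorems.EntropyRungSubcylindricalRecognitionCompactModelRecognition
import Literature.Topology.FourManifolds.HomotopyS4CompactProofs
import HarnessLib

/-!
# Route EntropyRung — `RecognitionOfEmergence` (item stmt-SmoothPoincare4-18300)

The glue of the crux-strategist decomposition (r1, 2026-08-17) of crux #3 `SubcylindricalRecognition` (RUNG,
stmt-SmoothPoincare4-10869) into three open leaves, none of which is the summit: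

* `ShrinkerEmerges` (stmt-SmoothPoincare4-17634) — the SPC4-free analytic core: on a closed CONNECTED 4-manifold,
  `R > 0` and Perelman's floor `μ(g,τ) ≥ ν_cyl + δ` (all `τ > 0`) produce a complete connected non-flat normalised
  gradient shrinking soliton of Gaussian mass `∫ e^{-f} dV > 32π²√π e^{-3/2}` which, if compact, immerses
  injectively into `M` (Bamler's tangent flow at `-∞` of the blow-up sequence, in route vocabulary);
* `NoncompactShrinkerGap` (#2, stmt-SmoothPoincare4-10868) — pure soliton geometry;
* `CompactShrinkerGap` (#4, stmt-SmoothPoincare4-10870) — SPC4-implied, converse unknown.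

`recognitionOfEmergence_proof : ShrinkerEmerges → NoncompactShrinkerGap → CompactShrinkerGap →
SubcylindricalRecognition` is PROVED here, sorry-free and fact-free (it is strategist s1's
`subcylindricalRecognition_of_shrinkerEmerges` of `Cruxes/SubcylindricalRecognition/StrategistSketchS1.lean`,
re-landed against the rendered route decls of rev 5): a non-compact emerging shrinker contradicts #2 (mass `>`
versus `≤`); a compact one immerses injectively into the connected `M ≃ₕ S⁴`, hence is diffeomorphic to `M`
(`stub_compactModelRecognition`, p72507), so it is a dense compact shrinker on a homotopy 4-sphere and #4 returns
its diffeomorphism to `S⁴`.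

`shrinkerEmerges_of_bamler : bamler_orbifoldTangentFlowAtInfinity_four → ShrinkerEmerges` records that the new leaf is
exactly the shadow of the named fact N1 (Bamler 2020a–c): the landed blow-up chain
`RecognitionOfShrinkerGaps.blowupSequence` (fact-free) followed by the landed blow-down
`RecognitionOfShrinkerGaps.blowdown_of` (cone points excluded by the floor) — so the live line
`ancient-sphere-rigidity` re-targets to the leaf in one line (RUNG modulo N1 alone is the already-landed
`RecognitionOfShrinkerGaps.subcylindricalRecognition_of_bamler`, not repeated here).

## References
* [Bamler2020Structure] R. Bamler, *Structure theory of non-collapsed limits of Ricci flows*, arXiv:2009.03243,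
  §2.7 Thm 2.40, §2.10 Thm 2.46.
* [Perelman2002] G. Perelman, *The entropy formula for the Ricci flow and its geometric applications*,
  arXiv:math/0211159, §3.1 (3.4), §4 Thm 4.1.
* [LeeSmoothManifolds2013] J. M. Lee, *Introduction to Smooth Manifolds*, 2nd ed., Thm. 4.29, Prop. 4.8, Thm. 4.14.
-/

noncomputable section

-- the registered namespace `Summit.SmoothPoincare4.SmoothPoincare4.Theorems` repeats a component
set_option linter.dupNamespace false

open scoped Manifold ContDiff ENNReal NNReal Topology ContinuousMap
open MeasureTheory Set Filter
open Literature.Geometry.Lorentzian Literature.Geometry.Riemannian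

namespace Summit.SmoothPoincare4.SmoothPoincare4.Theorems

open Summit.SmoothPoincare4.SmoothPoincare4.Theses.EntropyRung

namespace RecognitionOfEmergence

/-- `N1 → ShrinkerEmerges`: the leaf `ShrinkerEmerges` of route EntropyRung is the route-vocabulary shadow of the named
fact `bamler_orbifoldTangentFlowAtInfinity_four` — the landed (fact-free) blow-up chain
`RecognitionOfShrinkerGaps.blowupSequence` followed by the landed blow-down `RecognitionOfShrinkerGaps.blowdown_of`
run on N1. [cite: Bamler2020Structure, §2.7 Thm 2.40; §2.10 Thm 2.46] [cite: Perelman2002, §4, Thm. 4.1] -/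
theorem shrinkerEmerges_of_bamler (hN1 : bamler_orbifoldTangentFlowAtInfinity_four) :
    _root_.Summit.SmoothPoincare4.SmoothPoincare4.Theses.EntropyRung.ShrinkerEmerges := by
  intro M _ _ _ _ _ _ _ _ _ _ g _ hg hR hν
  obtain ⟨κ, δ', c, _hκ, hδ', hc, A, gk, covk, xk, hA, hflow, hRiem, hcurv, hpt, _hnc, hfloor⟩ :=
    RecognitionOfShrinkerGaps.blowupSequence M g hg hR hν
  exact RecognitionOfShrinkerGaps.blowdown_of hN1 M A gk covk xk δ' c hδ' hc hA hflow hRiem hcurv hpt hfloor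

/-- **The decomposition glue, sorry-free and fact-free**: `ShrinkerEmerges → NoncompactShrinkerGap →
CompactShrinkerGap → SubcylindricalRecognition`. A non-compact emerging shrinker contradicts the non-compact gap
(mass `>` versus `≤`); a compact one immerses injectively into the connected `M`, hence is diffeomorphic to
`M ≃ₕ S⁴` (`stub_compactModelRecognition`, landed p72507), so it is a dense compact shrinker on a homotopy 4-sphere
and the compact gap returns its diffeomorphism to `S⁴`. [cite: LeeSmoothManifolds2013, Thm. 4.29] -/
theorem subcylindricalRecognition_of_leaves
    (hE : _root_.Summit.SmoothPoincare4.SmoothPoincare4.Theses.EntropyRung.ShrinkerEmerges)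
    (h₂ : _root_.Summit.SmoothPoincare4.SmoothPoincare4.Theses.EntropyRung.NoncompactShrinkerGap)
    (h₄ : _root_.Summit.SmoothPoincare4.SmoothPoincare4.Theses.EntropyRung.CompactShrinkerGap) :
    _root_.Summit.SmoothPoincare4.SmoothPoincare4.Theses.EntropyRung.SubcylindricalRecognition := by
  intro M _ _ _ _ _ _ _ _ _ e g _ hg hR hν
  haveI : PathConnectedSpace (Metric.sphere (0 : EuclideanSpace ℝ (Fin 5)) 1) :=
    Literature.Topology.FourManifolds.pathConnectedSpace_sphere_four
  haveI : PathConnectedSpace M :=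
    Literature.Topology.FourManifolds.pathConnectedSpace_of_homotopyEquiv e
  obtain ⟨S, _, _, _, _, _, _, _, _, _, gS, _, fS, hS, hScomplete, hfS, hsol, hnorm, hSnonflat, hdens,
      hScouple⟩ := hE M g hg hR hν
  by_cases hSc : CompactSpace S
  · obtain ⟨φ, hφ, hφinj, hφimm⟩ := hScouple hSc
    obtain ⟨eSM⟩ :=
      _root_.Summit.SmoothPoincare4.SmoothPoincare4.Theorems.SubcylindricalRecognition.AncientSphereRigidity.stub_compactModelRecognition
        S M φ hφ hφinj hφimm
    have eS4 : S ≃ₕ Metric.sphere (0 : EuclideanSpace ℝ (Fin 5)) 1 :=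
      eSM.toHomeomorph.toHomotopyEquiv.trans e
    obtain ⟨eS⟩ := h₄ S eS4 gS fS hS hfS hsol hnorm hdens
    exact ⟨eSM.symm.trans eS⟩
  · haveI : NoncompactSpace S := not_compactSpace_iff.mp hSc
    have hle := h₂ S gS fS hS hScomplete hfS hsol hnorm hSnonflat
    exact absurd hdens (not_lt.mpr hle)

end RecognitionOfEmergence

/-- **`RecognitionOfEmergence` (stmt-SmoothPoincare4-18300) holds**: the glue of the r1 decomposition of RUNG,
`ShrinkerEmerges → NoncompactShrinkerGap → CompactShrinkerGap → SubcylindricalRecognition`, unconditionally.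
[cite: LeeSmoothManifolds2013, Thm. 4.29] [cite: Bamler2020Structure, §2.7 Thm 2.40] -/
theorem recognitionOfEmergence_proof :
    _root_.Summit.SmoothPoincare4.SmoothPoincare4.Theses.EntropyRung.RecognitionOfEmergence := by
  unfold _root_.Summit.SmoothPoincare4.SmoothPoincare4.Theses.EntropyRung.RecognitionOfEmergence
  exact RecognitionOfEmergence.subcylindricalRecognition_of_leaves

end Summit.SmoothPoincare4.SmoothPoincare4.Theorems

end
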